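/-
Copyright: the b2b-balaban cell (near-miss cell 7), T⁴-continuum fan-out; row NE7b ROUND-2 swarm, seat
t4-ne7b-formalise-leaf-03 (gen 2) (row S12 «ASSEMBLY», sub-row S12e «THE MULTIPLICITY SOCKET END» of
`t4/b2b-balaban-t4-ne7b-p1/LEAVES-NE7b.md`, ruling R-OWNER-22-24 (2); node A12-I.M of the typer's
`t4/formal/NE7b/DAG.md`).  Released under the licence of the surrounding project.
-/
import Summits.QuantumFields.BalabanUV.T4Continuum.Support.HistoryAssemblyMult
import Summits.QuantumFields.BalabanUV.T4Continuum.Support.HistoryAssemblyRealiseLE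
import Summits.QuantumFields.BalabanUV.T4Continuum.Support.HistoryGenAdm

/-!
# History assembly, MULTIPLICITY-KEYED: the physical members of realised pedigrees and their tree slots

Summits-side support file of the T⁴-continuum cell (rung (B)+1 on a FINITE torus only; NOT infinite volume, NOT the
mass gap, NOT the Clay statement; NOT a proof of the spine estimate NE7b).  Sub-row S12e «THE MULTIPLICITY SOCKET END»
(R-OWNER-22-24 (2)) of row S12, node A12-I.M of the typer's `t4/formal/NE7b/DAG.md`: the instantiation of the generic
multiplicity-keyed layer `HistoryAssemblyMult` (abstract key `ω`, `gmem`, `gslot`) for terms read as REALISED PEDIGREES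
(`HistoryAssemblyRealiseLE.RealisedReading`, reading map `ped`∕`cellP`∕`liveC`∕`cellOf`).  [folklore] finite bookkeeping
over the cell's own carriers; nothing printed asserted, no `[cite:]` tag, no `Prop`-valued fact minted (trigger c1).

WHY NAME-FREE.  The named member `(cellOf K τ c, (ped K τ).genT c) : γ × Gen (Lab α π)` carries the pedigree's
component and part NAMES in its tags (`HistoryGen.Tag`); two terms containing the SAME physical live component but
naming it differently are two named members.  Row S6g′'s count is of PHYSICAL placed genealogies; so the fine key of
the multiplicity-keyed assembly is the name-free member.

WHAT.  §1 **`geoOf K τ c := (cellOf K τ c, (ped K τ).toPGen (cellP K τ) c)`** — the PHYSICAL live member: root cell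
and leaf-09's census carrier `PGen` with (anchor, region) payloads, exactly the object `RealisedReading.real` realises;
**`gmemOf K τ`** (its image over the live components), the slot **`gslotP (x, g) := ⟨g.rootStep, x, g.toGen⟩`** and
**`bslotOf_eq_gslotP`**: it IS the named member's tree slot `HistorySocketTH.bslotOf Prod.fst` under the reading's
renewal-dating convention (leaf-09's `rootStep_toPGen` + `shape_genT_eq_toGen`); hence the two compatibilities of the
generic layer, **`image_gslotP_gmemOf`** (slot family of the physical family = `bstrOf`) and **`injOn_gslotP_gmemOf`**
(from distinct root cells).  §2 **`goccOf`** = `HistoryAssemblyMult.gocc` for this key — THE DISTINCT PHYSICAL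
GENEALOGIES OF BAD TERMS AT A TREE SLOT, the set row S6g′'s INSTANCE bounds (`mem_goccOf`).  §3 the kernel's
per-physical-member price **`supPrice`**: the MAXIMUM over the finitely many realisers `(τ, c)` of a physical member of
an abstract named price `pr K (cellOf K τ c, (ped K τ).genT c)` (no tag-invariance lemma is needed);
`pr_le_supPrice`, `exists_realiser_eq_supPrice`, **`prod_memOf_le_prod_supPrice`** (the per-term price over the named
members dominates by the product of `supPrice` over the physical family) and **`hocc_of_bound`** (the generic
per-occupant binder of `HistoryAssemblyMult.hF_of_multReading` from a per-realiser bound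
`#goccOf (slot) · pr ≤ priceT`).

HONEST DEPENDENCY (cell): continuum YM on T⁴ ⇐ BetaPertH ∧ nine spine estimates (0/9 proved); BetaPertH ⇐ (D1) ∧ (D4)
∧ CAP+tail.  Nothing of H3 ∕ (B) ∕ BetaPertH is discharged here; NE7b is NOT proved; no date.
-/

open Finset
open Literature.MathematicalPhysics.QuantumFieldTheory.Balaban1983to89
open Literature.MathematicalPhysics.QuantumFieldTheory.Balaban1983to89.B13ScaleTransfer
open T4PersistenceDictionary T4PersistentHistoryCount T4BankedInduction T4PrintedShapeBanking
open T4LiveClassFibration T4LiveStructureGas T4BranchingRecordsGas T4TaggedShapeBanking T4PartnerMultiplicity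
open Summit.QuantumFields.BalabanUV.T4Continuum.LateMergers
open Summit.QuantumFields.BalabanUV.T4Continuum.HistorySocketTH
open Summit.QuantumFields.BalabanUV.T4Continuum.HistoryAssemblyTerms
open Summit.QuantumFields.BalabanUV.T4Continuum.HistoryAssemblyTermsLE
open Summit.QuantumFields.BalabanUV.T4Continuum.HistoryAssemblyPedigree
open Summit.QuantumFields.BalabanUV.T4Continuum.HistoryAdmissible
open Summit.QuantumFields.BalabanUV.T4Continuum.HistoryGen
open Summit.QuantumFields.BalabanUV.T4Continuum.HistoryAssemblyMult

namespace Summit.QuantumFields.BalabanUV.T4Continuum.HistoryAssemblyMultRealise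

noncomputable section

/-! ## §1 The physical member of a realised pedigree, its family and its tree slot -/

section Physical

variable {ι α π γ : Type*} [DecidableEq α] [DecidableEq π] [DecidableEq γ] {d : ℕ}

/-- **THE PHYSICAL LIVE MEMBER** of the live component `c` of term `τ` at cutoff `K`: its root cell and its NAME-FREE
genealogy — leaf-09's census carrier `PGen` with (anchor, region) payloads, read off the pedigree (`Pedigree.toPGen`);
the object the reading's `real` field realises. [folklore] -/
def geoOf (ped : ℕ → ι → Pedigree α π) (cellP : ℕ → ι → π → Pt d × Finset (Pt d)) (cellOf : ℕ → ι → α → γ)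
    (K : ℕ) (τ : ι) (c : α) : γ × PGen (Pt d × Finset (Pt d)) :=
  (cellOf K τ c, (ped K τ).toPGen (cellP K τ) c)

/-- **THE PHYSICAL MEMBER FAMILY** of a term: the physical members of its live components. [folklore] -/
def gmemOf (ped : ℕ → ι → Pedigree α π) (cellP : ℕ → ι → π → Pt d × Finset (Pt d)) (liveC : ℕ → ι → Finset α)
    (cellOf : ℕ → ι → α → γ) (K : ℕ) (τ : ι) : Finset (γ × PGen (Pt d × Finset (Pt d))) :=
  (liveC K τ).image (geoOf ped cellP cellOf K τ)

/-- **THE TREE SLOT OF A PHYSICAL MEMBER**: (root step, root cell, canonical label). [folklore] -/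
def gslotP {δ : Type*} (w : γ × PGen δ) : BSlot γ PEv := ⟨w.2.rootStep, w.1, w.2.toGen⟩

/-- decidable equality of finite families of physical members — named, so that instance search finds it under `fibre` ∕
`badGMems` (the unaided search gives up on the nested `Finset (γ × PGen (Pt d × Finset (Pt d)))`). [folklore] -/
instance instDecidableEqFinsetPhys {δ : Type*} [DecidableEq δ] : DecidableEq (Finset (γ × PGen δ)) :=
  @Finset.decidableEq _ inferInstance

omit [DecidableEq α] [DecidableEq π] in
/-- membership in the physical member family. [folklore] -/
theorem mem_gmemOf {ped : ℕ → ι → Pedigree α π} {cellP : ℕ → ι → π → Pt d × Finset (Pt d)}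
    {liveC : ℕ → ι → Finset α} {cellOf : ℕ → ι → α → γ} {K : ℕ} {τ : ι} {w : γ × PGen (Pt d × Finset (Pt d))} :
    w ∈ gmemOf ped cellP liveC cellOf K τ ↔ ∃ c ∈ liveC K τ, geoOf ped cellP cellOf K τ c = w := mem_image

omit [DecidableEq γ] in
/-- **THE PHYSICAL MEMBER'S SLOT IS THE NAMED MEMBER'S SLOT** under the renewal-dating convention of the reading
(`renew_step`): root steps by `rootStep_toPGen`, shape trees by `shape_genT_eq_toGen` (leaf-09, row S3). [folklore] -/
theorem bslotOf_eq_gslotP (P : Pedigree α π) (cell : π → Pt d × Finset (Pt d))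
    (hS : ∀ c c', Part.old c' true ∈ P.parts c → P.step c' + 1 = P.step c) (x : γ) (c : α) :
    bslotOf Prod.fst (x, P.genT c) = gslotP (x, P.toPGen cell c) := by
  show (⟨(P.genT c).rootStep, x, relabel (shape ∘ Prod.fst) (P.genT c)⟩ : BSlot γ PEv) =
    ⟨(P.toPGen cell c).rootStep, x, (P.toPGen cell c).toGen⟩
  rw [P.rootStep_toPGen cell hS c, P.shape_genT_eq_toGen cell hS c]

variable {ped : ℕ → ι → Pedigree α π} {cellP : ℕ → ι → π → Pt d × Finset (Pt d)} {liveC : ℕ → ι → Finset α}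
  {cellOf : ℕ → ι → α → γ} {K : ℕ} {τ : ι}

/-- **COMPATIBILITY 1: THE SLOT FAMILY OF THE PHYSICAL FAMILY IS THE TERM'S LIVE CLASS** `bstrOf`. [folklore] -/
theorem image_gslotP_gmemOf (hS : ∀ c c', Part.old c' true ∈ (ped K τ).parts c → (ped K τ).step c' + 1 = (ped K τ).step c) :
    (gmemOf ped cellP liveC cellOf K τ).image gslotP = bstrOf Prod.fst (memOf ped liveC cellOf) K τ := by
  rw [gmemOf, bstrOf, memOf, image_image, image_image]
  refine image_congr fun c _ => ?_
  show gslotP (geoOf ped cellP cellOf K τ c) = bslotOf Prod.fst (cellOf K τ c, (ped K τ).genT c)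
  rw [bslotOf_eq_gslotP (ped K τ) (cellP K τ) hS]
  rfl

omit [DecidableEq α] [DecidableEq π] in
/-- **COMPATIBILITY 2: DISTINCT PHYSICAL MEMBERS OF ONE TERM SIT AT DISTINCT SLOTS** (distinct live components have
distinct root cells). [folklore] -/
theorem injOn_gslotP_gmemOf (hinj : Set.InjOn (cellOf K τ) (liveC K τ : Set α)) :
    Set.InjOn gslotP (gmemOf ped cellP liveC cellOf K τ : Set (γ × PGen (Pt d × Finset (Pt d)))) := by
  classical
  intro w hw w' hw' h
  obtain ⟨c, hc, rfl⟩ := mem_gmemOf.1 (Finset.mem_coe.1 hw)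
  obtain ⟨c', hc', rfl⟩ := mem_gmemOf.1 (Finset.mem_coe.1 hw')
  have hcell : cellOf K τ c = cellOf K τ c' := by
    have := congrArg (fun s : BSlot γ PEv => s.2.1) h
    simpa [gslotP, geoOf] using this
  rw [hinj (Finset.mem_coe.2 hc) (Finset.mem_coe.2 hc') hcell]

omit [DecidableEq α] [DecidableEq π] [DecidableEq γ] in
/-- the physical member map is injective on the live components of a term (distinct root cells). [folklore] -/
theorem injOn_geoOf (hinj : Set.InjOn (cellOf K τ) (liveC K τ : Set α)) :
    Set.InjOn (geoOf ped cellP cellOf K τ) (liveC K τ : Set α) := fun _ hc _ hc' h =>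
  hinj hc hc' (congrArg Prod.fst h)

omit [DecidableEq α] [DecidableEq π] [DecidableEq γ] in
/-- the named member map is injective on the live components of a term (distinct root cells). [folklore] -/
theorem injOn_named (hinj : Set.InjOn (cellOf K τ) (liveC K τ : Set α)) :
    Set.InjOn (fun c => (cellOf K τ c, (ped K τ).genT c)) (liveC K τ : Set α) := fun _ hc _ hc' h =>
  hinj hc hc' (congrArg Prod.fst h)

end Physical

/-! ## §2 The distinct physical genealogies of bad terms at a tree slot -/

section Occupants

variable {ι α π γ : Type*} [DecidableEq α] [DecidableEq π] [DecidableEq γ] {d : ℕ}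

/-- **THE DISTINCT PHYSICAL GENEALOGIES OF BAD TERMS AT A TREE SLOT** (with their root cells): the set row S6g′'s
INSTANCE bounds — `HistoryAssemblyMult.gocc` for the physical key. [folklore] -/
def goccOf (ped : ℕ → ι → Pedigree α π) (cellP : ℕ → ι → π → Pt d × Finset (Pt d)) (liveC : ℕ → ι → Finset α)
    (cellOf : ℕ → ι → α → γ) (jstar : ℕ → ℕ) (T : ℕ → Finset ι) (K : ℕ) (s : BSlot γ PEv) :
    Finset (γ × PGen (Pt d × Finset (Pt d))) :=
  gocc (memOf ped liveC cellOf) jstar T (gmemOf ped cellP liveC cellOf) gslotP K s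

variable {ped : ℕ → ι → Pedigree α π} {cellP : ℕ → ι → π → Pt d × Finset (Pt d)} {liveC : ℕ → ι → Finset α}
  {cellOf : ℕ → ι → α → γ} {jstar : ℕ → ℕ} {T : ℕ → Finset ι} {K : ℕ}

/-- **MEMBERSHIP**: a pair (root cell, physical genealogy) is an occupant of slot `s` iff it is the physical member of a
live component of a BAD term (one with a member born before `j⋆ K`) and its slot is `s`. [folklore] -/
theorem mem_goccOf {s : BSlot γ PEv} {w : γ × PGen (Pt d × Finset (Pt d))} :
    w ∈ goccOf ped cellP liveC cellOf jstar T K s ↔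
      ∃ τ ∈ badTerms (memOf ped liveC cellOf) jstar T K, ∃ c ∈ liveC K τ,
        geoOf ped cellP cellOf K τ c = w ∧ gslotP w = s := by
  rw [goccOf, mem_gocc]
  constructor
  · rintro ⟨τ, hτ, hw, hs⟩
    obtain ⟨c, hc, rfl⟩ := mem_gmemOf.1 hw
    exact ⟨τ, hτ, c, hc, rfl, hs⟩
  · rintro ⟨τ, hτ, c, hc, rfl, hs⟩
    exact ⟨τ, hτ, mem_gmemOf.2 ⟨c, hc, rfl⟩, hs⟩

end Occupants

/-! ## §3 The kernel's price of a physical member: the maximum over its realisers -/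

section SupPrice

variable {ι α π γ : Type*} [DecidableEq α] [DecidableEq π] [DecidableEq γ] {d : ℕ}

/-- **THE REALISERS OF A PHYSICAL MEMBER**: the pairs (bad term, live component) whose physical member it is. [folklore] -/
def realisers (ped : ℕ → ι → Pedigree α π) (cellP : ℕ → ι → π → Pt d × Finset (Pt d)) (liveC : ℕ → ι → Finset α)
    (cellOf : ℕ → ι → α → γ) (jstar : ℕ → ℕ) (T : ℕ → Finset ι) (K : ℕ) (w : γ × PGen (Pt d × Finset (Pt d))) :
    Finset ((_ : ι) × α) :=
  ((badTerms (memOf ped liveC cellOf) jstar T K).sigma fun τ => liveC K τ).filter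
    fun x => geoOf ped cellP cellOf K x.1 x.2 = w

/-- **THE KERNEL'S PRICE OF A PHYSICAL MEMBER**: the MAXIMUM, over its realisers, of a named per-member price `pr`
(the H3-side printed price of the named member); `0` if it has no realiser. [folklore] -/
def supPrice (ped : ℕ → ι → Pedigree α π) (cellP : ℕ → ι → π → Pt d × Finset (Pt d)) (liveC : ℕ → ι → Finset α)
    (cellOf : ℕ → ι → α → γ) (jstar : ℕ → ℕ) (T : ℕ → Finset ι) (pr : ℕ → γ × Gen (Lab α π) → ℝ) (K : ℕ)
    (w : γ × PGen (Pt d × Finset (Pt d))) : ℝ :=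
  if h : (realisers ped cellP liveC cellOf jstar T K w).Nonempty then
    (realisers ped cellP liveC cellOf jstar T K w).sup' h fun x => pr K (cellOf K x.1 x.2, (ped K x.1).genT x.2)
  else 0

variable {ped : ℕ → ι → Pedigree α π} {cellP : ℕ → ι → π → Pt d × Finset (Pt d)} {liveC : ℕ → ι → Finset α}
  {cellOf : ℕ → ι → α → γ} {jstar : ℕ → ℕ} {T : ℕ → Finset ι} {pr : ℕ → γ × Gen (Lab α π) → ℝ} {K : ℕ}

/-- membership in the realisers. [folklore] -/
theorem mem_realisers {w : γ × PGen (Pt d × Finset (Pt d))} {x : (_ : ι) × α} :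
    x ∈ realisers ped cellP liveC cellOf jstar T K w ↔
      x.1 ∈ badTerms (memOf ped liveC cellOf) jstar T K ∧ x.2 ∈ liveC K x.1 ∧ geoOf ped cellP cellOf K x.1 x.2 = w := by
  simp only [realisers, mem_filter, mem_sigma, and_assoc]

/-- **EVERY REALISER'S NAMED PRICE IS BELOW THE KERNEL'S PRICE** of its physical member. [folklore] -/
theorem pr_le_supPrice {τ : ι} (hτ : τ ∈ badTerms (memOf ped liveC cellOf) jstar T K) {c : α} (hc : c ∈ liveC K τ) :
    pr K (cellOf K τ c, (ped K τ).genT c) ≤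
      supPrice ped cellP liveC cellOf jstar T pr K (geoOf ped cellP cellOf K τ c) := by
  have hx : (⟨τ, c⟩ : (_ : ι) × α) ∈ realisers ped cellP liveC cellOf jstar T K (geoOf ped cellP cellOf K τ c) :=
    mem_realisers.2 ⟨hτ, hc, rfl⟩
  unfold supPrice
  rw [dif_pos ⟨_, hx⟩]
  exact le_sup' (fun x : (_ : ι) × α => pr K (cellOf K x.1 x.2, (ped K x.1).genT x.2)) hx

/-- the kernel's price is nonnegative for a nonnegative named price. [folklore] -/
theorem supPrice_nonneg (hpr : ∀ q, 0 ≤ pr K q) (w : γ × PGen (Pt d × Finset (Pt d))) :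
    0 ≤ supPrice ped cellP liveC cellOf jstar T pr K w := by
  unfold supPrice
  split_ifs with h
  · obtain ⟨x, hx⟩ := h
    exact (hpr _).trans (le_sup' (fun x : (_ : ι) × α => pr K (cellOf K x.1 x.2, (ped K x.1).genT x.2)) hx)
  · exact le_rfl

/-- **THE KERNEL'S PRICE OF AN OCCUPANT IS ATTAINED BY A REALISER.** [folklore] -/
theorem exists_realiser_eq_supPrice {s : BSlot γ PEv} {w : γ × PGen (Pt d × Finset (Pt d))}
    (hw : w ∈ goccOf ped cellP liveC cellOf jstar T K s) :
    ∃ τ ∈ badTerms (memOf ped liveC cellOf) jstar T K, ∃ c ∈ liveC K τ, geoOf ped cellP cellOf K τ c = w ∧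
      supPrice ped cellP liveC cellOf jstar T pr K w = pr K (cellOf K τ c, (ped K τ).genT c) := by
  obtain ⟨τ, hτ, c, hc, hgeo, -⟩ := mem_goccOf.1 hw
  have hne : (realisers ped cellP liveC cellOf jstar T K w).Nonempty := ⟨⟨τ, c⟩, mem_realisers.2 ⟨hτ, hc, hgeo⟩⟩
  obtain ⟨x, hx, heq⟩ := exists_mem_eq_sup' hne fun x : (_ : ι) × α => pr K (cellOf K x.1 x.2, (ped K x.1).genT x.2)
  obtain ⟨hx1, hx2, hx3⟩ := mem_realisers.1 hx
  refine ⟨x.1, hx1, x.2, hx2, hx3, ?_⟩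
  unfold supPrice
  rw [dif_pos hne, heq]

/-- **THE PER-TERM NAMED PRICE IS BELOW THE PRODUCT OF THE KERNEL'S PRICES OVER THE PHYSICAL FAMILY** (for a bad term
with distinct root cells and a nonnegative named price). [folklore] -/
theorem prod_memOf_le_prod_supPrice (hpr : ∀ q, 0 ≤ pr K q) {τ : ι}
    (hτ : τ ∈ badTerms (memOf ped liveC cellOf) jstar T K) (hinj : Set.InjOn (cellOf K τ) (liveC K τ : Set α)) :
    ∏ q ∈ memOf ped liveC cellOf K τ, pr K q ≤
      ∏ w ∈ gmemOf ped cellP liveC cellOf K τ, supPrice ped cellP liveC cellOf jstar T pr K w := by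
  rw [memOf, prod_image (injOn_named hinj), gmemOf, prod_image (injOn_geoOf hinj)]
  exact prod_le_prod (fun c _ => hpr _) fun c hc => pr_le_supPrice hτ hc

variable {sh : Lab α π → PEv}

/-- **THE GENERIC PER-OCCUPANT BINDER FROM A PER-REALISER BOUND**: if every live component `c` of every bad term
satisfies `#goccOf (slot of c) · pr K (named c) ≤ priceT … K (named c)`, and the reading dates renewals one step after
the renewed part, then at every slot every physical occupant `w` satisfies
`#goccOf s · supPrice K w ≤ bslotPrice (yT …) s` (the arg-max realiser, `bslotOf_eq_gslotP`, `priceT_le_yT`). [folklore] -/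
theorem hocc_of_bound {C : T4PrintedShapeBanking.Consts} {Λ' : ℝ} {R : ℕ → ℕ → ℕ} {g : ℕ → ℕ → ℝ}
    (hS : ∀ τ ∈ badTerms (memOf ped liveC cellOf) jstar T K, ∀ c c',
      Part.old c' true ∈ (ped K τ).parts c → (ped K τ).step c' + 1 = (ped K τ).step c)
    (hbound : ∀ τ ∈ badTerms (memOf ped liveC cellOf) jstar T K, ∀ c ∈ liveC K τ,
      ((goccOf ped cellP liveC cellOf jstar T K (gslotP (geoOf ped cellP cellOf K τ c))).card : ℝ) *
          pr K (cellOf K τ c, (ped K τ).genT c) ≤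
        priceT Prod.fst C Λ' R g K (cellOf K τ c, (ped K τ).genT c)) :
    ∀ s, ∀ w ∈ goccOf ped cellP liveC cellOf jstar T K s,
      ((goccOf ped cellP liveC cellOf jstar T K s).card : ℝ) * supPrice ped cellP liveC cellOf jstar T pr K w ≤
        bslotPrice (yT Prod.fst C Λ' R g (memOf ped liveC cellOf) jstar T K) s := by
  intro s w hw
  obtain ⟨τ, hτ, c, hc, hgeo, hsup⟩ := exists_realiser_eq_supPrice (pr := pr) hw
  have hslot : gslotP w = s := by
    obtain ⟨-, -, -, -, -, hs⟩ := mem_goccOf.1 hw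
    exact hs
  have hq : (cellOf K τ c, (ped K τ).genT c) ∈ memOf ped liveC cellOf K τ := mem_memOf.2 ⟨c, hc, rfl⟩
  have hb := hbound τ hτ c hc
  rw [hgeo, hslot] at hb
  rw [hsup]
  refine hb.trans ?_
  have hy := priceT_le_yT (sh := Prod.fst) (C := C) (Λ' := Λ') (R := R) (g := g) hτ hq
  have hs' : s = bslotOf Prod.fst (cellOf K τ c, (ped K τ).genT c) := by
    rw [bslotOf_eq_gslotP (ped K τ) (cellP K τ) (hS τ hτ), ← hslot, ← hgeo]; rfl
  rw [hs']
  exact hy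

end SupPrice

end

end Summit.QuantumFields.BalabanUV.T4Continuum.HistoryAssemblyMultRealise
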